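import Summits.QuantumFields.YangMills.Theorems.FluctuationComparisonRegPrIntLS2BetaTubularChartDockLocal
import Summits.QuantumFields.YangMills.Theorems.FluctuationComparisonRegPrIntLS2BetaCombConnectivity
import Literature.MathematicalPhysics.QuantumFieldTheory.Balaban1983to89.Node00.AveragingSmooth
import Mathlib.Analysis.SpecialFunctions.Exponential
import HarnessLib

/-!
# S2β · HESS∘ AT THE FLAT DATUM — brick 3: THE TUBE OF RECORD IS TRANSVERSAL TO THE CENTRE-VANISHING PURE GAUGES (the `hT` letter)

Cell `ym3-torus` (YM ladder rung R3 = continuum `SU(2)` Yang–Mills on the three-torus at fixed lattice data — a RUNG: NOT d = 4, NOT infinite volume,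
NOT a mass gap, NOT Clay).  Width seat `ym3-torus-px16` (gen 17), brick 3 of the «FLAT INHABITANT of the (T)-chain» pen (★★OWNER g40 №238, px21 g18 GO
22:49Z; px13 g19 23:34Z OFFER∕LOCATE read — «MINE» 23:36Z).  Crux `stmt-QuantumFields-20520` (`…Theses.UnitScaleTilt.FluctuationComparisonRegPrIntL`), LINE S2β;
`--kind proof --supports stmt-QuantumFields-20520 --as helper`: count-neutral, DEFINITION-FREE (0 `def`, 0 `instance`, 0 `notation`, 0 `sorry`, default heartbeats).

WHY.  ✓brick 2 `…S2BetaFlatSecondVariationAlongCurve.hessPos_flat_of_transversal` proves HESS∘ at the flat datum `(V ≡ 1, U₀ ≡ 1)` for ANY chart `Ψ` that is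
`C²`, flat-fibre-valued near `0`, and TRANSVERSAL at first order to the centre-vanishing pure gauges:
`hT : ∀ φ, (∀ x, φ (embIter (K−J) x) = 0) → ∀ y, (∀ b, fderiv ℝ (coeField ∘ Ψ) 0 y b = φ b.tgt − φ b.src) → y = 0`.
THIS FILE PROVES `hT` for the chart of the (T)-chain, `Ψ y := Φ (σ y)` with `σ` THE TUBE OF RECORD (the rows of
✓`…S2BetaTubularChartDockLocal.exists_tubularHaarChart_pivotAct_local`, VERBATIM: frozen at `U₀` on the comb and pivot bonds, conjugated exponential
coordinates `eV` on the free bonds) and `Φ` ANY map agreeing with the identity off the pivot bonds near `σ 0` (the window chart `c.Φ (V, ·)`: clause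
`hoffT` on the carrier given by `hne`∕`hnhds`) — DATUM-FREE (any `V`, any `U₀`), so it serves every datum's Landau∕axial bookkeeping, not only the flat one.

WHAT.
* ADDITIVE COMB CONNECTIVITY (`φ` zero at the `k`-centres with zero increments along `combSet k` ⇒ `φ ≡ 0`) is IMPORTED BY NAME: ✓px13 g19
  `…S2BetaCombConnectivity.eq_zero_of_combInvariant_of_embIter` (its LOCATE 23:34Z named the decomposition (a)(b)(c) used here).
* `eq_zero_of_unitary_sandwich` (`A·(C⋆XC) = 0`, `A, C ∈ SU(2)` ⇒ `X = 0`) and ★★★`transversal_of_tube_rows`: the `hT` text VERBATIM for `Ψ y := Φ (σ y)`.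
  Proof: off the pivots the components of `D(coeField ∘ Φ ∘ σ)(0)` are those of `σ` (eventual agreement `hoff` + uniqueness of the derivative); on the comb
  bonds `σ` is frozen, so they vanish (✓`iterCentralBond_not_mem_combSet`: comb bonds are not pivots); a centre-vanishing `φ` with `dφ = DΨ(0)y` therefore has
  zero comb increments ⇒ `φ ≡ 0` (px13's lemma) ⇒ `DΨ(0)y = 0`; on a free bond `b` the row (F4a) reads `σ y b = U₀ b·(T⋆·Θ((eV y)_b)·T)` with `ρ(Θ X) = e^X`
  (lit ✓`IsChartRep.rho_expChart`) and `De^X(0) = 1` (Mathlib `hasFDerivAt_exp_zero`), so `U₀ b·(T⋆·(eV y)_b·T) = 0` ⇒ `(eV y)_b = 0` ⇒ `eV y = 0` ⇒ `y = 0`.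

HONEST.  Kinematics of the chart (first-order transversality); with ✓brick 2 the only rows of HESS∘ at the flat datum left to discharge on (T3)'s clause texts
are bookkeeping (`C²` ⟸ ✓(T2e); `Φ (σ 0) = 1` ⟸ `hσ0`+`hself`; flat-fibre-valued near `0` and `hoff` ⟸ `hoffT`+`hne`+`hnhds`); HESS∘ at a general datum
([Balaban1985BackgroundPropagators] Thm 3.11), ISOL∘(δ), TUBE-REG∘, GAP♯∘, EXW∘, S2β and crux 20520 are NOT proved; rung R3 = `YM3TorusSU2` as filed — SU(2) YM₃
on T³; the Yang–Mills mass gap is NOT proved.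
[cite: Balaban1985Variational, (19) p.281, (142) p.299, (181) p.307; Balaban1985UV3, (18)-(22) p.260; Balaban1985Averaging, (8) p.19]
-/

noncomputable section

open Filter Topology NormedSpace
open scoped Matrix.Norms.L2Operator
open Literature.MathematicalPhysics.QuantumFieldTheory.Balaban1983to89
open Literature.MathematicalPhysics.QuantumFieldTheory.Balaban1983to89.T3ContinuumYM3Torus (T3Family)
open Literature.MathematicalPhysics.QuantumFieldTheory.Balaban1983to89.HaarExponentialChart
open Literature.MathematicalPhysics.QuantumFieldTheory.Balaban1983to89.LogChartProduct
open Literature.MathematicalPhysics.QuantumFieldTheory.Balaban1983to89.B15DeterminingSets (embIter)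
open Literature.MathematicalPhysics.QuantumLattice (fundamentalRep fundamentalRep_apply)
open Node00 (coeField)
open Summit.QuantumFields.YangMills.Theorems.FluctuationComparisonRegPrIntLWregChain (iterCentralBond)
open Summit.QuantumFields.YangMills.Theorems.FluctuationComparisonRegPrIntLS2BetaSignedComb (combTransporter)
open Summit.QuantumFields.YangMills.Theorems.FluctuationComparisonRegPrIntLS2BetaSignedCombKill (combSet)
open Summit.QuantumFields.YangMills.Theorems.FluctuationComparisonRegPrIntLS2BetaSignedCombCount (iterCentralBond_not_mem_combSet)
open Summit.QuantumFields.YangMills.Theorems.FluctuationComparisonRegPrIntLS2BetaCombConnectivity (eq_zero_of_combInvariant_of_embIter)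

namespace Summit.QuantumFields.YangMills.Theorems.FluctuationComparisonRegPrIntLS2BetaTubeOfRecordTransversal

/-! ## The tube of record is transversal to the centre-vanishing pure gauges -/

section Tube

variable (F : T3Family) {J K : ℕ} {dV : ℕ}

/-- Unitary sandwich cancellation: `A·(C⋆·X·C) = 0` with `A`, `C` special unitary forces `X = 0`. [folklore] -/
theorem eq_zero_of_unitary_sandwich (A C : Matrix.specialUnitaryGroup (Fin 2) ℂ) (X : Matrix (Fin 2) (Fin 2) ℂ)
    (h0 : (A : Matrix (Fin 2) (Fin 2) ℂ) * (star (C : Matrix (Fin 2) (Fin 2) ℂ) * X * (C : Matrix (Fin 2) (Fin 2) ℂ)) = 0) : X = 0 := by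
  have hA : star (A : Matrix (Fin 2) (Fin 2) ℂ) * (A : Matrix (Fin 2) (Fin 2) ℂ) = 1 := A.prop.1.1
  have hC : (C : Matrix (Fin 2) (Fin 2) ℂ) * star (C : Matrix (Fin 2) (Fin 2) ℂ) = 1 := C.prop.1.2
  calc X = ((C : Matrix (Fin 2) (Fin 2) ℂ) * star (C : Matrix (Fin 2) (Fin 2) ℂ)) * X *
        ((C : Matrix (Fin 2) (Fin 2) ℂ) * star (C : Matrix (Fin 2) (Fin 2) ℂ)) := by rw [hC, one_mul, mul_one]
    _ = (C : Matrix (Fin 2) (Fin 2) ℂ) * (star (C : Matrix (Fin 2) (Fin 2) ℂ) * X * (C : Matrix (Fin 2) (Fin 2) ℂ)) *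
        star (C : Matrix (Fin 2) (Fin 2) ℂ) := by simp only [mul_assoc]
    _ = (C : Matrix (Fin 2) (Fin 2) ℂ) * (star (A : Matrix (Fin 2) (Fin 2) ℂ) * ((A : Matrix (Fin 2) (Fin 2) ℂ) *
        (star (C : Matrix (Fin 2) (Fin 2) ℂ) * X * (C : Matrix (Fin 2) (Fin 2) ℂ)))) * star (C : Matrix (Fin 2) (Fin 2) ℂ) := by
          rw [← mul_assoc (star (A : Matrix (Fin 2) (Fin 2) ℂ)), hA, one_mul]
    _ = 0 := by rw [h0, mul_zero, mul_zero, zero_mul]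

/-- ★★★ **THE TUBE OF RECORD IS TRANSVERSAL TO THE CENTRE-VANISHING PURE GAUGES, AT FIRST ORDER** — the `hT` letter of
✓`…S2BetaFlatSecondVariationAlongCurve.hessPos_flat_of_transversal` ∕ ✓`…S2BetaFlatFibreTangent.hessPos_flat_of_transversal_of_chainRule` for the chart
`Ψ y := Φ (σ y)`, where `σ` is the tube of record (rows of ✓`…S2BetaTubularChartDockLocal.exists_tubularHaarChart_pivotAct_local`: frozen at `U₀` on the comb
and pivot bonds, conjugated exponential coordinates `eV` on the free bonds) and `Φ` any map that agrees with the identity OFF the pivot bonds near `σ 0`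
(the window chart `c.Φ (V,·)` of the (T)-chain: clause `hoffT` on the carrier `hne`∕`hnhds`).  DATUM-FREE (any `V`, any `U₀`).  Proof: the velocity
`DΨ(0)y` equals `Dσ(0)y` off the pivots, hence vanishes on the comb bonds; a centre-vanishing `φ` with `dφ = DΨ(0)y` therefore has zero increments along
the comb ⇒ `φ ≡ 0` (✓`…S2BetaCombConnectivity`) ⇒ `DΨ(0)y = 0` ⇒ on each free bond `U₀ b·T⁻¹·(eV y)_b·T = 0` ⇒ `(eV y)_b = 0` ⇒ `y = 0`.
[cite: Balaban1985Variational, (19) p.281, (142) p.299, (181) p.307; Balaban1985UV3, (18)-(22) p.260] -/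
theorem transversal_of_tube_rows (hk : K - J ≤ (F.P K).m + (F.P K).K)
    [DecidablePred (· ∈ (combSet (K - J) : Set (PBond (F.P K) 0)) ∪ Set.range (iterCentralBond (P := F.P K) (K - J)))]
    (Φ : GaugeField (F.P K) 0 (Matrix.specialUnitaryGroup (Fin 2) ℂ) → GaugeField (F.P K) 0 (Matrix.specialUnitaryGroup (Fin 2) ℂ))
    (U₀ : GaugeField (F.P K) 0 (Matrix.specialUnitaryGroup (Fin 2) ℂ))
    (σ : EuclideanSpace ℝ (Fin dV) → GaugeField (F.P K) 0 (Matrix.specialUnitaryGroup (Fin 2) ℂ))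
    (eV : EuclideanSpace ℝ (Fin dV) ≃L[ℝ] (piLogChart (specialUnitaryLogChart (Fin 2))
      {b : PBond (F.P K) 0 // b ∉ (combSet (K - J) : Set (PBond (F.P K) 0)) ∪ Set.range (iterCentralBond (P := F.P K) (K - J))}).lie)
    (hσcomb : ∀ y, ∀ b ∈ (combSet (K - J) : Set (PBond (F.P K) 0)) ∪ Set.range (iterCentralBond (P := F.P K) (K - J)), σ y b = U₀ b)
    (hσfree : ∀ y (b : PBond (F.P K) 0) (hb : b ∉ (combSet (K - J) : Set (PBond (F.P K) 0)) ∪ Set.range (iterCentralBond (P := F.P K) (K - J))),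
        σ y b = U₀ b * ((combTransporter (K - J) U₀ b.tgt)⁻¹ *
          (isChartRep_specialUnitaryGroup (n := Fin 2)).expChart
            (lieApply (specialUnitaryLogChart (Fin 2)) {b : PBond (F.P K) 0 // b ∉ (combSet (K - J) : Set (PBond (F.P K) 0)) ∪
              Set.range (iterCentralBond (P := F.P K) (K - J))} (eV y) ⟨b, hb⟩) *
          combTransporter (K - J) U₀ b.tgt))
    (hoff : ∀ᶠ y in 𝓝 (0 : EuclideanSpace ℝ (Fin dV)), ∀ b : PBond (F.P K) 0,
      (∀ c', iterCentralBond (P := F.P K) (K - J) c' ≠ b) → Φ (σ y) b = σ y b)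
    (hΨd : DifferentiableAt ℝ (fun y => coeField (Φ (σ y))) 0) :
    ∀ φ : Site (F.P K) 0 → Matrix (Fin 2) (Fin 2) ℂ, (∀ x : Site (F.P K) (K - J), φ (embIter (K - J) x) = 0) →
      ∀ y : EuclideanSpace ℝ (Fin dV), (∀ b : PBond (F.P K) 0, fderiv ℝ (fun y => coeField (Φ (σ y))) 0 y b = φ b.tgt - φ b.src) → y = 0 := by
  intro φ hroot y hy
  have hfd : HasFDerivAt (fun y => coeField (Φ (σ y))) (fderiv ℝ (fun y => coeField (Φ (σ y))) 0) 0 := hΨd.hasFDerivAt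
  -- (1) off the pivots, the components of `D(coeField ∘ Φ ∘ σ)(0)` are the derivatives of the components of `σ`
  have hcomp : ∀ b : PBond (F.P K) 0, (∀ c', iterCentralBond (P := F.P K) (K - J) c' ≠ b) →
      ∀ {D : EuclideanSpace ℝ (Fin dV) →L[ℝ] Matrix (Fin 2) (Fin 2) ℂ},
        HasFDerivAt (fun y => ((σ y b : Matrix.specialUnitaryGroup (Fin 2) ℂ) : Matrix (Fin 2) (Fin 2) ℂ)) D 0 →
          ∀ y, fderiv ℝ (fun y => coeField (Φ (σ y))) 0 y b = D y := by
    intro b hb D hD y'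
    have h1 : HasFDerivAt (fun y => coeField (Φ (σ y)) b)
        ((ContinuousLinearMap.proj b).comp (fderiv ℝ (fun y => coeField (Φ (σ y))) 0)) 0 := hasFDerivAt_pi'.1 hfd b
    have heq : (fun y => coeField (Φ (σ y)) b) =ᶠ[𝓝 0] fun y => ((σ y b : Matrix.specialUnitaryGroup (Fin 2) ℂ) : Matrix (Fin 2) (Fin 2) ℂ) :=
      hoff.mono fun y hy' => by
        show ((Φ (σ y) b : Matrix.specialUnitaryGroup (Fin 2) ℂ) : Matrix (Fin 2) (Fin 2) ℂ) = _
        rw [hy' b hb]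
    have h2 : HasFDerivAt (fun y => coeField (Φ (σ y)) b) D 0 := hD.congr_of_eventuallyEq heq
    have h3 := congrArg (fun L : EuclideanSpace ℝ (Fin dV) →L[ℝ] Matrix (Fin 2) (Fin 2) ℂ => L y') (h1.unique h2)
    simpa using h3
  -- (2) on the comb bonds the derivative vanishes (`σ` is frozen there, and comb bonds are not pivots)
  have hcombS : ∀ b ∈ (combSet (K - J) : Set (PBond (F.P K) 0)), ∀ c', iterCentralBond (P := F.P K) (K - J) c' ≠ b :=
    fun b hb c' hc => iterCentralBond_not_mem_combSet hk c' (hc ▸ hb)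
  have hzero_comb : ∀ b ∈ (combSet (K - J) : Set (PBond (F.P K) 0)), fderiv ℝ (fun y => coeField (Φ (σ y))) 0 y b = 0 := fun b hb => by
    have hconst : HasFDerivAt (fun y => ((σ y b : Matrix.specialUnitaryGroup (Fin 2) ℂ) : Matrix (Fin 2) (Fin 2) ℂ)) (0 : EuclideanSpace ℝ (Fin dV) →L[ℝ] Matrix (Fin 2) (Fin 2) ℂ) 0 := by
      have : (fun y => ((σ y b : Matrix.specialUnitaryGroup (Fin 2) ℂ) : Matrix (Fin 2) (Fin 2) ℂ)) = fun _ => ((U₀ b : Matrix.specialUnitaryGroup (Fin 2) ℂ) : Matrix (Fin 2) (Fin 2) ℂ) :=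
        funext fun y => by rw [hσcomb y b (Or.inl hb)]
      rw [this]
      exact hasFDerivAt_const _ _
    simpa using hcomp b (hcombS b hb) hconst y
  -- (3) hence `φ ≡ 0`, and every component of the derivative vanishes
  have hφ : φ = 0 := eq_zero_of_combInvariant_of_embIter hk φ (fun b hb => by
    have := hy b
    rw [hzero_comb b hb] at this
    exact sub_eq_zero.1 this.symm) hroot
  have hall : ∀ b, fderiv ℝ (fun y => coeField (Φ (σ y))) 0 y b = 0 := fun b => by rw [hy b, hφ]; simp
  -- (4) on a free bond the derivative is the conjugated coordinate, so the coordinate vanishes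
  have hfree : ∀ bb : {b : PBond (F.P K) 0 // b ∉ (combSet (K - J) : Set (PBond (F.P K) 0)) ∪ Set.range (iterCentralBond (P := F.P K) (K - J))},
      ((eV y : (piLogChart (specialUnitaryLogChart (Fin 2)) {b : PBond (F.P K) 0 // b ∉ (combSet (K - J) : Set (PBond (F.P K) 0)) ∪ Set.range (iterCentralBond (P := F.P K) (K -
            J))}).lie) : {b : PBond (F.P K) 0 // b ∉ (combSet (K - J) : Set (PBond (F.P K) 0)) ∪ Set.range (iterCentralBond (P := F.P K) (K - J))} → Matrix (Fin 2) (Fin 2) ℂ) bb = 0 := by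
    rintro ⟨b, hb⟩
    -- the coordinate on `b` as a continuous linear function of `y`
    obtain ⟨Lb, hLb⟩ : ∃ Lb : EuclideanSpace ℝ (Fin dV) →L[ℝ] Matrix (Fin 2) (Fin 2) ℂ, ∀ y',
        Lb y' = ((eV y' : (piLogChart (specialUnitaryLogChart (Fin 2)) {b : PBond (F.P K) 0 // b ∉ (combSet (K - J) : Set (PBond (F.P K) 0)) ∪ Set.range (iterCentralBond (P := F.P K)
              (K - J))}).lie) : {b : PBond (F.P K) 0 // b ∉ (combSet (K - J) : Set (PBond (F.P K) 0)) ∪ Set.range (iterCentralBond (P := F.P K) (K - J))} → Matrix (Fin 2) (Fin 2) ℂ) ⟨b, hb⟩ :=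
      ⟨(ContinuousLinearMap.proj (R := ℝ) (φ := fun _ : {b : PBond (F.P K) 0 // b ∉ (combSet (K - J) : Set (PBond (F.P K) 0)) ∪ Set.range (iterCentralBond (P := F.P K) (K - J))} =>
            Matrix (Fin 2) (Fin 2) ℂ) ⟨b, hb⟩).comp
        ((piLogChart (specialUnitaryLogChart (Fin 2)) {b : PBond (F.P K) 0 // b ∉ (combSet (K - J) : Set (PBond (F.P K) 0)) ∪ Set.range (iterCentralBond (P := F.P K) (K -
              J))}).lie.subtypeL.comp (eV : EuclideanSpace ℝ (Fin dV) →L[ℝ] (piLogChart (specialUnitaryLogChart (Fin 2)) {b : PBond (F.P K) 0 // b ∉ (combSet (K - J) : Set (PBond (F.P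
              K) 0)) ∪ Set.range (iterCentralBond (P := F.P K) (K - J))}).lie)),
        fun y' => rfl⟩
    -- the component of `σ` on the free bond, as a formula `U₀ b · (T⋆ · e^(Lb y) · T)`
    have hinv : (((combTransporter (K - J) U₀ b.tgt)⁻¹ : Matrix.specialUnitaryGroup (Fin 2) ℂ) : Matrix (Fin 2) (Fin 2) ℂ) = star ((combTransporter (K - J) U₀ b.tgt :
          Matrix.specialUnitaryGroup (Fin 2) ℂ) : Matrix (Fin 2) (Fin 2) ℂ) := rfl
    have hformula : (fun y' => ((σ y' b : Matrix.specialUnitaryGroup (Fin 2) ℂ) : Matrix (Fin 2) (Fin 2) ℂ)) = fun y' =>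
        ((U₀ b : Matrix.specialUnitaryGroup (Fin 2) ℂ) : Matrix (Fin 2) (Fin 2) ℂ) * (star ((combTransporter (K - J) U₀ b.tgt : Matrix.specialUnitaryGroup (Fin 2) ℂ) : Matrix (Fin 2)
              (Fin 2) ℂ) * exp (Lb y') *
          ((combTransporter (K - J) U₀ b.tgt : Matrix.specialUnitaryGroup (Fin 2) ℂ) : Matrix (Fin 2) (Fin 2) ℂ)) := by
      funext y'
      have hexp := (isChartRep_specialUnitaryGroup (n := Fin 2)).rho_expChart
        (lieApply (specialUnitaryLogChart (Fin 2)) {b : PBond (F.P K) 0 // b ∉ (combSet (K - J) : Set (PBond (F.P K) 0)) ∪ Set.range (iterCentralBond (P := F.P K) (K - J))} (eV y') ⟨b, hb⟩)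
      rw [fundamentalRep_apply, coe_lieApply] at hexp
      rw [hσfree y' b hb, Submonoid.coe_mul, Submonoid.coe_mul, Submonoid.coe_mul, hinv, hexp, hLb]
    -- its derivative at `0`
    have hexp0 : HasFDerivAt (fun X : Matrix (Fin 2) (Fin 2) ℂ => exp X) (1 : Matrix (Fin 2) (Fin 2) ℂ →L[ℝ] Matrix (Fin 2) (Fin 2) ℂ) (Lb 0) := by
      rw [map_zero]
      exact hasFDerivAt_exp_zero
    have hD : HasFDerivAt (fun y' => ((σ y' b : Matrix.specialUnitaryGroup (Fin 2) ℂ) : Matrix (Fin 2) (Fin 2) ℂ))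
        (((ContinuousLinearMap.mul ℝ (Matrix (Fin 2) (Fin 2) ℂ) ((U₀ b : Matrix.specialUnitaryGroup (Fin 2) ℂ) : Matrix (Fin 2) (Fin 2) ℂ)).comp
          (ContinuousLinearMap.mulLeftRight ℝ (Matrix (Fin 2) (Fin 2) ℂ) (star ((combTransporter (K - J) U₀ b.tgt : Matrix.specialUnitaryGroup (Fin 2) ℂ) : Matrix (Fin 2) (Fin 2) ℂ))
            ((combTransporter (K - J) U₀ b.tgt : Matrix.specialUnitaryGroup (Fin 2) ℂ) : Matrix (Fin 2) (Fin 2) ℂ))).comp ((1 : Matrix (Fin 2) (Fin 2) ℂ →L[ℝ] Matrix (Fin 2) (Fin 2)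
                  ℂ).comp Lb)) 0 := by
      rw [hformula]
      exact (((ContinuousLinearMap.mul ℝ (Matrix (Fin 2) (Fin 2) ℂ) _).comp (ContinuousLinearMap.mulLeftRight ℝ (Matrix (Fin 2) (Fin 2) ℂ) _ _)).hasFDerivAt).comp 0
        (hexp0.comp 0 Lb.hasFDerivAt)
    have hfb := hcomp b (fun c' hc => hb (Or.inr ⟨c', hc⟩)) hD y
    rw [hall b] at hfb
    simp only [ContinuousLinearMap.comp_apply, one_apply_eq_self, ContinuousLinearMap.mulLeftRight_apply,
      ContinuousLinearMap.mul_apply'] at hfb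
    rw [← hLb]
    exact eq_zero_of_unitary_sandwich (U₀ b) (combTransporter (K - J) U₀ b.tgt) (Lb y) hfb.symm
  have hcoe : ((eV y : (piLogChart (specialUnitaryLogChart (Fin 2)) {b : PBond (F.P K) 0 // b ∉ (combSet (K - J) : Set (PBond (F.P K) 0)) ∪ Set.range (iterCentralBond (P := F.P K) (K -
        J))}).lie) : {b : PBond (F.P K) 0 // b ∉ (combSet (K - J) : Set (PBond (F.P K) 0)) ∪ Set.range (iterCentralBond (P := F.P K) (K - J))} → Matrix (Fin 2) (Fin 2) ℂ) = 0 := funext hfree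
  have heV : eV y = 0 := by
    ext1
    simpa using hcoe
  simpa using eV.injective (heV.trans (map_zero eV).symm)

end Tube

end Summit.QuantumFields.YangMills.Theorems.FluctuationComparisonRegPrIntLS2BetaTubeOfRecordTransversal

end
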